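import Summits.QuantumFields.YangMills.Theorems.FluctuationComparisonRegPrIntLOrganTangentFibreMeanVersionMW
import Summits.QuantumFields.YangMills.Theorems.FluctuationComparisonRegPrIntLOrganTangentAPackageDescendTo
import Summits.QuantumFields.YangMills.Theorems.FluctuationComparisonRegPrIntLRunpairOrganFibreLawDefs
import Literature.MathematicalPhysics.QuantumFieldTheory.Balaban1983to89.BalabanAdmissibleClassParams
import Literature.MathematicalPhysics.QuantumFieldTheory.Balaban1983to89.T4AveragingDisintegration
import Literature.MathematicalPhysics.QuantumFieldTheory.Balaban1983to89.T4CubeChartExp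
import HarnessLib

/-!
# Route `UnitScaleTilt` — crux `FluctuationComparisonRegPrIntL` (stmt-QuantumFields-20520, rung R3), PATH-B organ: «ORGAN DISCHARGE INPUTS (HJ), NEAR-PAIR «sq» EDITION v0.4ᴱ = v0.4 ᴱ RE-LETTERED (v19 «BACKGROUND WINDOWS»)» — DEFINITIONS
# (LEAD `ym-ust-20520-w3` g28 RULING №60 (E) «BACKGROUND WINDOWS» ∕ RULING №61 (D) ∕ №44–№47 (names by the V03∕V04 recipe with suffix V04E); ROW bytes by ideator `ym-r3-idea-1` g31 (PRE e5b64ff5ff716873), `crux write` by LEAD w3 g28 (№47 READ PASS, №48 WRITTEN 18:38:12Z, commit b31260f07b3d); letter by `ym3-torus-px8` g25; this cut by width seat `ym-ust-20520-w4` g26)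

Definitions file (route-posited object, `--kind definition --supports stmt-QuantumFields-20520 --as helper`): ONE `def OrganDischargeInputsHJsq : Prop` — same SHORT name as
✓`…RunpairOrganDischargeInputsHJsqDefs` (v0.1), ✓`…V03Defs` (v0.3) and ✓`…RunpairOrganDischargeInputsHJsqV04Defs` (v0.4, p823642, body ws16 d7cc2b2598f430a6), DISTINCT fully-qualified
name (namespace `…RunpairOrganDischargeInputsHJsqV04E`; consumers write it FULLY QUALIFIED, LEAD RULING №99) — whose body is BYTE-IDENTICAL to the crux workfile
`Cruxes/FluctuationComparisonRegPrIntL/DischargeInputsHJsq.lean` in its v0.4ᴱ edition (tree sha16 e5b64ff5ff716873, body ws16 3fb47081410e8564; script `cut_defs.py` (w4 g25, HOME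
`ym-ust-20520-w4/g25/v04pred/`): imports kept, namespace re-pointed, nothing retyped), so that the Theorems-side knit `…OrganTangentSpreadFibreLawHJsqOfDischargeInputsSqV04E`
(`OrganDischargeInputsHJsq`(v0.4ᴱ) `→` ✓`…RunpairOrganFibreLawJSqE.SpreadFibreLawHJsq`, p823865's proof verbatim over px19 g22's A5 door ✓p823618) and the apex
`…OrganTangentOneStepTransportUHOfDischargeInputsHJsqV04E` can import it.  v0.4ᴱ = v0.4 with EXACTLY the two «block ⑤» tokens of the frame
  `(∃ κ : ℝ, MemAtHeight F ℰp j (prm j) (fun U => Real.exp κ * ρ j U))` ∕ `(∃ κ : ℝ, MemAtHeight F ℰp j (prm j) (fun U => Real.exp κ * ρ' j U))`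
replaced by px8 g25's (E)-LETTER `Φ_h[ρ j]` ∕ `Φ_h[ρ' j]` (letter v1.2 f5a4b1f3847b408f §3, Φ_h text sha16 c203073e1d310439 = ideator digests `PhiH.rho.j.TOKEN` a6abbca136248afb ∕
`PhiH.rhoP.j.TOKEN` e781df8eda55a4eb; SPEC-1 shape `∃ K (hjK : j ≤ K), ∃ κ, …`; background map `bg` on the `(prm j).δ`-window, polymer data `(supp, foot, len, wt, act)` with feet
`iterBlockOf (K - j) b.src`, `cst`, `lf`, two-sided `e^{-β·A(bg V) + Σ act + cst ∓ slack}` window bounds on `PlaqSmall ((prm j).δ·(L⁻¹)^{2(K−j)}) (bg V)`, `Measurable`∕`GaugeInvariant`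
of the reading as conjuncts (SPEC-2∕3; extraction lemmas ✓p830750 `…ELetterExtraction`)) plus ONE `open …B5Eq118OneStroke (iterBlockOf)` line — LEAD №47 (A) READ PASS by script:
A1–A5, (I-geo)sq, (I-law) A2′ «AE», (I-cov)sq, seed, tie, chart [0]–[11] byte-kept from v0.4 (tree 599197e642c5d86c); so v0.4's module docstring (p823642) describes every clause
of this row except the class-membership letter.

WHY (RULING №60 (E); px8 g25 §69.17∕§69.17-A; instr-1 g15; px20 g23 critic): the old letter types class membership through lit `MemOfRun`'s CUT-HEIGHT datum windows, measured
unsatisfiable at `L = 3` AS TYPED (a currency artefact of the typed letter, not of print); the (E) letter re-types it through print's BACKGROUND windows ([Balaban1985Averaging]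
(10)–(13) p.19) and the whole sq-chain (E1 ✓`…RunpairOrganFibreLawJSqEDefs` → knits → sq-apex → THIS row (E6) → knit-V04ᴱ (E7) → apex-V04ᴱ (E8); LEAD №44∕№47, w4 g26 №23) and
the line text v19.0 consume ONE letter.

WHAT THIS IS ∕ IS NOT.  A HYPOTHESIS ROW (NOT printed as a theorem) — EXACTLY AS OPEN as v0.4 and as `SpreadFibreLawHJsq`(ᴱ); `hdisp`, REG′, KER′, the crude curvature letters
`kG kB ES Good`, the chart letters and now the background-window letters `bg supp foot len wt act cst lf` are what a discharger must PROVE from [Balaban1985Variational] Thm 1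
p.279 ∕ Prop 9 p.309, [Balaban1985Averaging] (9)–(13) p.19, [Balaban1987RG1] Thm 1 p.259 ∕ Thm 3 p.264 — SOURCES of the shapes only; NOTHING of these is asserted or proved
here.  `SpreadFibreLawH(J)` ∕ `SpreadFibreLawHJsq`(ᴱ) ∕ every ROW-2 ∕ ROW-sq edition UNDISCHARGED; crux 20520, the five registered stubs of `Lines/runpair_organ.lean` (registry
3732b7df, untouched), O1ᵘ-H and `YM3TorusSU2` NOT proved; rung R3 = SU(2) YM₃ on T³ at fixed lattice data — NOT d = 4, NOT infinite volume, NOT a mass gap, NOT Clay.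

No `theorem`, no `instance`, no `notation`, no attribute changes.
-/

set_option autoImplicit false

noncomputable section

namespace Summit.QuantumFields.YangMills.Theorems.FluctuationComparisonRegPrIntLRunpairOrganDischargeInputsHJsqV04E

open MeasureTheory Filter Topology Function
open Set (Icc)
open scoped ENNReal NNReal BigOperators
open Literature.MathematicalPhysics.QuantumFieldTheory.Balaban1983to89 T3ContinuumYM3Torus T3NestedUnitLaws
  T3UnitLawDensityEML T4Continuum BalabanUVClass T3UnitScaleTilt T3LevelShift T3TiltDescent
-- v0.4ᴱ: px8 g25's (E) letter Φ_h names lit `iterBlockOf` (the blocks' feet); nothing else of that file is used.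
open Literature.MathematicalPhysics.QuantumFieldTheory.Balaban1983to89.B5Eq118OneStroke (iterBlockOf)
open T4CubeChartExp (expPt)
open Summit.QuantumFields.YangMills.Theorems.FluctuationComparisonRegPrIntLRunpairOrganFibreLaw (mwCut wNum wgt)

/-- «ORGAN DISCHARGE INPUTS (HJ)», NEAR-PAIR «sq» EDITION v0.4 = v0.3 + A5 ((I-curv) re-cut to the Cauchy road: per-`t` letters `kG kB ES`, tie
`Σ_{B'} (kG + ES·kB)·e^{κ·tdist} ≤ NT·(D_j∕D_Ts)·w + δT_j·D_j` (right member verbatim), crude GOOD-SET clause `hG` (letter `kG`, on `Good ∩ {ŵ ≠ 0}`) and crude clause `hcrude`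
(letter `kB`, on `{ŵ ≠ 0}`), both at near CORNERS only; no `kP gP KP KP2`, no `HasDerivWithinAt` data); v0.3 = v0.2 + A2′ ((I-law) AE); v0.2 = v0.1 + A1 + A2 + A3;
(I-geo)sq ∕ (I-law) ∕ (I-cov)sq ∕ prefix ∕ chart ∕ seed unchanged from v0.3.  A HYPOTHESIS ROW exactly as open as `SpreadFibreLawHJsq`; shapes after [Balaban1985Variational]
Thm 1∕Prop 9∕(185), [Balaban1985Averaging] (9)–(13), [Balaban1987RG1] Thm 1∕Thm 3∕(3.17) — SOURCES only, nothing asserted. -/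
def OrganDischargeInputsHJsq : Prop :=
  ∃ pW : ℝ, ∃ γ₁ : ℝ, 0 < γ₁ ∧ ∀ (F : T3Family) (γ : ℝ), 0 < γ → γ ≤ γ₁ → ∀ (b₀ p₀ : ℝ) (j₀ : ℕ) (prm : ℕ → ClassParams) (η : ℕ → ℝ) (rA : ℝ) (Bρ : ℕ → ℝ), 0 < b₀ → 0 < p₀ → pW ≤ p₀ → AdmissibleClassParams F γ b₀ p₀ prm → (∀ j, 0 ≤ η j) → Summable η → Summable (fun i => ∑' k, η (k + i)) → Tendsto (fun j => (∑' k, η (k + j)) * ((1 + 2 * ((F.L : ℝ) ^ j / γ) * (Fintype.card (Plaq (F.P j) 0) : ℝ)) * (Fintype.card (PBond (F.P j) 0) : ℝ) ^ 2)) atTop (𝓝 0) → 0 < rA → ∃ κ₀ : ℝ, 0 < κ₀ ∧ ∀ (κ : ℝ), 0 < κ → κ ≤ κ₀ → ∃ (rc w₀ NT NX NL CJ NV1 NV2 NV3 NV4 : ℝ) (δT δX δL δV1 δV2 δV3 δV4 : ℕ → ℝ) (j₁ : ℕ), 0 < rc ∧ 0 < w₀ ∧ 0 ≤ NT ∧ 0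 ≤ NX ∧ 0 ≤ NL ∧ 0 ≤ CJ ∧ (∀ n, 0 ≤ δT n ∧ 0 ≤ δX n ∧ 0 ≤ δL n) ∧ Summable δT ∧ Summable (fun i => ∑' k, δT (k + i)) ∧ Tendsto (fun j => (∑' k, δT (k + j)) * ((1 + 2 * ((F.L : ℝ) ^ j / γ) * (Fintype.card (Plaq (F.P j) 0) : ℝ)) * (Fintype.card (PBond (F.P j) 0) : ℝ) ^ 2)) atTop (𝓝 0) ∧ Summable δX ∧ Summable (fun i => ∑' k, δX (k + i)) ∧ Tendsto (fun j => (∑' k, δX (k + j)) * ((1 + 2 * ((F.L : ℝ) ^ j / γ) * (Fintype.card (Plaq (F.P j) 0) : ℝ)) * (Fintype.card (PBond (F.P j) 0) : ℝ) ^ 2)) atTop (𝓝 0) ∧ Summable δL ∧ Summable (fun i => ∑' k, δL (k + i)) ∧ Tendsto (fun j => (∑' k, δL (k + j)) * ((1 + 2 * ((F.L : ℝ) ^ j / γ) * (Fintype.card (Plaq (F.P j) 0) : ℝ)) * (Fintype.card (PBond (F.P j) 0) : ℝ) ^ 2)) atTop (𝓝 0) ∧ (0 ≤ NV1 ∧ 0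 ≤ NV2 ∧ 0 ≤ NV3 ∧ 0 ≤ NV4 ∧ (∀ n, 0 ≤ δV1 n ∧ 0 ≤ δV2 n ∧ 0 ≤ δV3 n ∧ 0 ≤ δV4 n) ∧ (Summable δV1 ∧ Summable (fun i => ∑' k, δV1 (k + i)) ∧ Tendsto (fun j => (∑' k, δV1 (k + j)) * ((1 + 2 * ((F.L : ℝ) ^ j / γ) * (Fintype.card (Plaq (F.P j) 0) : ℝ)) * (Fintype.card (PBond (F.P j) 0) : ℝ) ^ 2)) atTop (𝓝 0)) ∧ (Summable δV2 ∧ Summable (fun i => ∑' k, δV2 (k + i)) ∧ Tendsto (fun j => (∑' k, δV2 (k + j)) * ((1 + 2 * ((F.L : ℝ) ^ j / γ) * (Fintype.card (Plaq (F.P j) 0) : ℝ)) * (Fintype.card (PBond (F.P j) 0) : ℝ) ^ 2)) atTop (𝓝 0)) ∧ (Summable δV3 ∧ Summable (fun i => ∑' k, δV3 (k + i)) ∧ Tendsto (fun j => (∑' k, δV3 (k + j)) * ((1 + 2 * ((F.L : ℝ) ^ j / γ) * (Fintype.card (Plaq (F.P j) 0) : ℝ)) * (Fintype.card (PBond (F.P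 j) 0) : ℝ) ^ 2)) atTop (𝓝 0)) ∧ (Summable δV4 ∧ Summable (fun i => ∑' k, δV4 (k + i)) ∧ Tendsto (fun j => (∑' k, δV4 (k + j)) * ((1 + 2 * ((F.L : ℝ) ^ j / γ) * (Fintype.card (Plaq (F.P j) 0) : ℝ)) * (Fintype.card (PBond (F.P j) 0) : ℝ) ^ 2)) atTop (𝓝 0))) ∧ j₀ ≤ j₁ ∧ ∀ (ν : ℕ → (j : ℕ) → MeasureTheory.Measure (GaugeField (F.P j) 0 ↥(Matrix.specialUnitaryGroup (Fin 2) ℂ))), (∀ K, ν K K = T4GenFunBounds.gibbsMeasure (F.P K) ((F.scheme ℰp γ).β K)) → (∀ K j, j < K → ν K j = Measure.map (descend F ℰp j) (ν K (j + 1))) → ∀ (K K' : ℕ), K ≤ K' → ∀ (Ts T : ℕ), Ts < T → T ≤ K → ∀ (μ μ' : ((j : ℕ) → MeasureTheory.Measure (GaugeField (F.P j) 0 ↥(Matrix.specialUnitaryGroup (Fin 2) ℂ)))) (ρ ρ' : ((j : ℕ) → GaugeField (F.P j) 0 ↥(Matrix.specialUnitaryGroup (Fin 2) ℂ) → ℝ)),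 (∀ j : ℕ, Ts ≤ j → j ≤ T → μ j = ν K j ∧ μ' j = ν K' j) → (∀ j : ℕ, j < Ts → μ j = Measure.map (descend F ℰp j) ((μ (j + 1)).withDensity (fun U => ENNReal.ofReal ((∏ p : Plaq _ _, max 0 (min 1 ((24 / 25 * (θBal F.L γ b₀ p₀ (j + 1)) - dist1 (GaugeField.plaqHol U p)) / ((24 / 25 - 1 / 2) * (θBal F.L γ b₀ p₀ (j + 1))))))))) ∧ μ' j = Measure.map (descend F ℰp j) ((μ' (j + 1)).withDensity (fun U => ENNReal.ofReal ((∏ p : Plaq _ _, max 0 (min 1 ((24 / 25 * (θBal F.L γ b₀ p₀ (j + 1)) - dist1 (GaugeField.plaqHol U p)) / ((24 / 25 - 1 / 2) * (θBal F.L γ b₀ p₀ (j + 1)))))))))) → (∀ j : ℕ, Ts ≤ j → j < T → μ j = Measure.map (descend F ℰp j) (μ (j + 1)) ∧ μ' j = Measure.map (descend F ℰp j) (μ' (j + 1))) → (∀ j : ℕ, j ≤ T → IsFiniteMeasure (μ j) ∧ IsFiniteMeasure (μ' j)) → (∀ j : ℕ, j₀ ≤ j → j ≤ T → ((∀ U,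 PlaqSmall (θBal F.L γ b₀ p₀ j) U → 0 < ρ j U ∧ 0 < ρ' j U) ∧ μ j = (fieldMeasure _ _ _).withDensity (fun U => ENNReal.ofReal (ρ j U)) ∧ μ' j = (fieldMeasure _ _ _).withDensity (fun U => ENNReal.ofReal (ρ' j U)) ∧ (∃ (K : ℕ) (hjK : j ≤ K),
        ∃ κ : ℝ, ∃ (bg : GaugeField (F.P K) (K - j) (Matrix.specialUnitaryGroup (Fin 2) ℂ) → GaugeField (F.P K) 0 (Matrix.specialUnitaryGroup (Fin 2) ℂ))
          (nDom : ℕ) (supp : Fin nDom → Set (PBond (F.P K) 0)) (foot : Fin nDom → Finset (Site (F.P K) (K - j)))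
          (len : Fin nDom → ℝ) (wt : Fin nDom → ℝ) (act : Fin nDom → GaugeField (F.P K) 0 (Matrix.specialUnitaryGroup (Fin 2) ℂ) → ℝ)
          (cst : ℝ) (lf : GaugeField (F.P K) (K - j) (Matrix.specialUnitaryGroup (Fin 2) ℂ) → ℝ),
          (∀ V, 0 ≤ readAtLevel F hjK (fun U => Real.exp κ * ρ j U) V) ∧
          Measurable (readAtLevel F hjK (fun U => Real.exp κ * ρ j U)) ∧
          GaugeField.GaugeInvariant (readAtLevel F hjK (fun U => Real.exp κ * ρ j U)) ∧
          (∀ V, PlaqSmall (prm j).δ V →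
            IsBackground (fun i => BlockAveraging.blockAvg (P := F.P K) (j := i) ℰp) {U | PlaqSmall (prm j).δreg U} (K - j) V (bg V)) ∧
          (∀ X, (foot X).Nonempty) ∧ (∀ X b, b ∈ supp X → iterBlockOf (K - j) b.src ∈ foot X) ∧ (∀ X, 0 ≤ len X) ∧ (∀ X, 0 ≤ wt X) ∧
          (∀ X, ∀ y ∈ foot X, ∀ y' ∈ foot X, (Site.tdist y y' : ℝ) ≤ (prm j).M * (len X + 1)) ∧
          (∀ X (U U' : GaugeField (F.P K) 0 (Matrix.specialUnitaryGroup (Fin 2) ℂ)), (∀ b ∈ supp X, U b = U' b) → act X U = act X U') ∧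
          (∀ X, GaugeField.GaugeInvariant (act X)) ∧
          (∀ X V, PlaqSmall (prm j).δ V → PlaqSmall ((prm j).δ * ((F.L : ℝ)⁻¹) ^ (2 * (K - j))) (bg V) →
            |act X (bg V)| ≤ wt X * Real.exp (-((prm j).κ * len X))) ∧
          (∀ y : Site (F.P K) (K - j), ∑ X ∈ Finset.univ.filter (fun X => y ∈ foot X), wt X * Real.exp (-((prm j).κ * len X)) ≤ (prm j).Ccov) ∧
          |cst| ≤ (prm j).cE * Fintype.card (Site (F.P K) (K - j)) ∧
          (∀ V, PlaqSmall (prm j).δ V → PlaqSmall ((prm j).δ * ((F.L : ℝ)⁻¹) ^ (2 * (K - j))) (bg V) →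
            Real.exp (-((prm j).β * wilsonAction4 (bg V)) + (∑ X, act X (bg V)) + cst - (prm j).slack) ≤ readAtLevel F hjK (fun U => Real.exp κ * ρ j U) V) ∧
          (∀ V, PlaqSmall (prm j).δ V → PlaqSmall ((prm j).δ * ((F.L : ℝ)⁻¹) ^ (2 * (K - j))) (bg V) →
            readAtLevel F hjK (fun U => Real.exp κ * ρ j U) V ≤ Real.exp (-((prm j).β * wilsonAction4 (bg V)) + (∑ X, act X (bg V)) + cst + (prm j).slack) + lf V) ∧
          (∀ V, 0 ≤ lf V) ∧ (∀ V, lf V ≤ Real.exp (-(prm j).cLF) * Real.exp ((prm j).c5 * Fintype.card (Site (F.P K) (K - j)))) ∧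
          (∀ V (S : Finset (Plaq (F.P K) (K - j))), (∀ p ∈ S, (prm j).δL ≤ dist1 (GaugeField.plaqHol V p)) →
            readAtLevel F hjK (fun U => Real.exp κ * ρ j U) V ≤ Real.exp (-((prm j).cLF * S.card)) * Real.exp ((prm j).c5 * Fintype.card (Site (F.P K) (K - j))))) ∧ (∃ (K : ℕ) (hjK : j ≤ K),
        ∃ κ : ℝ, ∃ (bg : GaugeField (F.P K) (K - j) (Matrix.specialUnitaryGroup (Fin 2) ℂ) → GaugeField (F.P K) 0 (Matrix.specialUnitaryGroup (Fin 2) ℂ))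
          (nDom : ℕ) (supp : Fin nDom → Set (PBond (F.P K) 0)) (foot : Fin nDom → Finset (Site (F.P K) (K - j)))
          (len : Fin nDom → ℝ) (wt : Fin nDom → ℝ) (act : Fin nDom → GaugeField (F.P K) 0 (Matrix.specialUnitaryGroup (Fin 2) ℂ) → ℝ)
          (cst : ℝ) (lf : GaugeField (F.P K) (K - j) (Matrix.specialUnitaryGroup (Fin 2) ℂ) → ℝ),
          (∀ V, 0 ≤ readAtLevel F hjK (fun U => Real.exp κ * ρ' j U) V) ∧
          Measurable (readAtLevel F hjK (fun U => Real.exp κ * ρ' j U)) ∧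
          GaugeField.GaugeInvariant (readAtLevel F hjK (fun U => Real.exp κ * ρ' j U)) ∧
          (∀ V, PlaqSmall (prm j).δ V →
            IsBackground (fun i => BlockAveraging.blockAvg (P := F.P K) (j := i) ℰp) {U | PlaqSmall (prm j).δreg U} (K - j) V (bg V)) ∧
          (∀ X, (foot X).Nonempty) ∧ (∀ X b, b ∈ supp X → iterBlockOf (K - j) b.src ∈ foot X) ∧ (∀ X, 0 ≤ len X) ∧ (∀ X, 0 ≤ wt X) ∧
          (∀ X, ∀ y ∈ foot X, ∀ y' ∈ foot X, (Site.tdist y y' : ℝ) ≤ (prm j).M * (len X + 1)) ∧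
          (∀ X (U U' : GaugeField (F.P K) 0 (Matrix.specialUnitaryGroup (Fin 2) ℂ)), (∀ b ∈ supp X, U b = U' b) → act X U = act X U') ∧
          (∀ X, GaugeField.GaugeInvariant (act X)) ∧
          (∀ X V, PlaqSmall (prm j).δ V → PlaqSmall ((prm j).δ * ((F.L : ℝ)⁻¹) ^ (2 * (K - j))) (bg V) →
            |act X (bg V)| ≤ wt X * Real.exp (-((prm j).κ * len X))) ∧
          (∀ y : Site (F.P K) (K - j), ∑ X ∈ Finset.univ.filter (fun X => y ∈ foot X), wt X * Real.exp (-((prm j).κ * len X)) ≤ (prm j).Ccov) ∧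
          |cst| ≤ (prm j).cE * Fintype.card (Site (F.P K) (K - j)) ∧
          (∀ V, PlaqSmall (prm j).δ V → PlaqSmall ((prm j).δ * ((F.L : ℝ)⁻¹) ^ (2 * (K - j))) (bg V) →
            Real.exp (-((prm j).β * wilsonAction4 (bg V)) + (∑ X, act X (bg V)) + cst - (prm j).slack) ≤ readAtLevel F hjK (fun U => Real.exp κ * ρ' j U) V) ∧
          (∀ V, PlaqSmall (prm j).δ V → PlaqSmall ((prm j).δ * ((F.L : ℝ)⁻¹) ^ (2 * (K - j))) (bg V) →
            readAtLevel F hjK (fun U => Real.exp κ * ρ' j U) V ≤ Real.exp (-((prm j).β * wilsonAction4 (bg V)) + (∑ X, act X (bg V)) + cst + (prm j).slack) + lf V) ∧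
          (∀ V, 0 ≤ lf V) ∧ (∀ V, lf V ≤ Real.exp (-(prm j).cLF) * Real.exp ((prm j).c5 * Fintype.card (Site (F.P K) (K - j)))) ∧
          (∀ V (S : Finset (Plaq (F.P K) (K - j))), (∀ p ∈ S, (prm j).δL ≤ dist1 (GaugeField.plaqHol V p)) →
            readAtLevel F hjK (fun U => Real.exp κ * ρ' j U) V ≤ Real.exp (-((prm j).cLF * S.card)) * Real.exp ((prm j).c5 * Fintype.card (Site (F.P K) (K - j))))) ∧ μ j {U | ¬ PlaqSmall (θBal F.L γ b₀ p₀ j) U} ≤ ENNReal.ofReal (η j) ∧ μ' j {U | ¬ PlaqSmall (θBal F.L γ b₀ p₀ j) U} ≤ ENNReal.ofReal (η j) ∧ (ContinuousOn (ρ j) {U | PlaqSmall (θBal F.L γ b₀ p₀ j) U} ∧ ContinuousOn (ρ' j) {U | PlaqSmall (θBal F.L γ b₀ p₀ j) U}) ∧ ((∀ (U : GaugeField _ _ ↥(Matrix.specialUnitaryGroup (Fin 2) ℂ)), PlaqSmall (49 / 50 * θBal F.L γ b₀ p₀ j) U → ∀ (b b' : PBond _ _) (v v' : Fin 3 → ℝ),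 ‖v‖ ≤ 1 → ‖v'‖ ≤ 1 → ∃ g : ℂ × ℂ → ℂ, DifferentiableOn ℂ g (Metric.ball (0 : ℂ) (rA * (49 / 50 * θBal F.L γ b₀ p₀ j)) ×ˢ Metric.ball (0 : ℂ) (rA * (49 / 50 * θBal F.L γ b₀ p₀ j))) ∧ (∀ (s t : ℝ) (V Z : GaugeField _ _ ↥(Matrix.specialUnitaryGroup (Fin 2) ℂ)), |s| < rA * (49 / 50 * θBal F.L γ b₀ p₀ j) → |t| < rA * (49 / 50 * θBal F.L γ b₀ p₀ j) → (∀ e, e ≠ b → V e = U e) → V b = U b * expPt (s • v) → (∀ e, e ≠ b' → Z e = V e) → Z b' = V b' * expPt (t • v') → g ((s : ℂ), (t : ℂ)) = (((Real.log (ρ j Z)) : ℝ) : ℂ)) ∧ ∀ z ∈ Metric.ball (0 : ℂ) (rA * (49 / 50 * θBal F.L γ b₀ p₀ j)) ×ˢ Metric.ball (0 : ℂ) (rA * (49 / 50 * θBal F.L γ b₀ p₀ j)), ‖g z - g 0‖ ≤ (Bρ j)) ∧ (∀ (U : GaugeField _ _ ↥(Matrix.specialUnitaryGroup (Fin 2)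 ℂ)), PlaqSmall (49 / 50 * θBal F.L γ b₀ p₀ j) U → ∀ (b b' : PBond _ _) (v v' : Fin 3 → ℝ), ‖v‖ ≤ 1 → ‖v'‖ ≤ 1 → ∃ g : ℂ × ℂ → ℂ, DifferentiableOn ℂ g (Metric.ball (0 : ℂ) (rA * (49 / 50 * θBal F.L γ b₀ p₀ j)) ×ˢ Metric.ball (0 : ℂ) (rA * (49 / 50 * θBal F.L γ b₀ p₀ j))) ∧ (∀ (s t : ℝ) (V Z : GaugeField _ _ ↥(Matrix.specialUnitaryGroup (Fin 2) ℂ)), |s| < rA * (49 / 50 * θBal F.L γ b₀ p₀ j) → |t| < rA * (49 / 50 * θBal F.L γ b₀ p₀ j) → (∀ e, e ≠ b → V e = U e) → V b = U b * expPt (s • v) → (∀ e, e ≠ b' → Z e = V e) → Z b' = V b' * expPt (t • v') → g ((s : ℂ), (t : ℂ)) = (((Real.log (ρ' j Z)) : ℝ) : ℂ)) ∧ ∀ z ∈ Metric.ball (0 : ℂ) (rA * (49 / 50 * θBal F.L γ b₀ p₀ j)) ×ˢ Metric.ball (0 : ℂ) (rA * (49 / 50 * θBal F.L γ b₀ p₀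 j)), ‖g z - g 0‖ ≤ (Bρ j))))) → ∀ (j : ℕ), j₁ ≤ j → ∀ (hjTs : j + 1 ≤ Ts), ∃ (Z : Type) (_ : MeasurableSpace Z) (τ : MeasureTheory.Measure Z) (Φ : GaugeField (F.P j) 0 ↥(Matrix.specialUnitaryGroup (Fin 2) ℂ) × Z → GaugeField (F.P Ts) 0 ↥(Matrix.specialUnitaryGroup (Fin 2) ℂ)) (J : GaugeField (F.P j) 0 ↥(Matrix.specialUnitaryGroup (Fin 2) ℂ) × Z → NNReal) (S : Set (GaugeField (F.P Ts) 0 ↥(Matrix.specialUnitaryGroup (Fin 2) ℂ))) (π : Site (F.P Ts) 0 → Site (F.P j) 0), MeasureTheory.IsProbabilityMeasure τ ∧ Measurable Φ ∧ Measurable J ∧ MeasurableSet S ∧ (∀ U : GaugeField (F.P Ts) 0 ↥(Matrix.specialUnitaryGroup (Fin 2) ℂ), (∀ (n : ℕ) (hjn : j + 1 ≤ n) (hnK : n ≤ Ts), PlaqSmall (24 / 25 * θBal F.L γ b₀ p₀ n) (descendTo F ℰp n Ts hnK U)) → U ∈ S) ∧ (∀ V z, descendTo F ℰp j Ts (Nat.le_of_succ_le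 hjTs) (Φ (V, z)) = V) ∧ (∀ A : Set (GaugeField (F.P j) 0 ↥(Matrix.specialUnitaryGroup (Fin 2) ℂ)), MeasurableSet A → (fieldMeasure (F.P Ts) 0 ↥(Matrix.specialUnitaryGroup (Fin 2) ℂ)).restrict (descendTo F ℰp j Ts (Nat.le_of_succ_le hjTs) ⁻¹' A ∩ S) = ((((fieldMeasure (F.P j) 0 ↥(Matrix.specialUnitaryGroup (Fin 2) ℂ)).restrict A).prod τ).withDensity (fun p => (J p : ENNReal))).map Φ) ∧ (∀ f : GaugeField (F.P Ts) 0 ↥(Matrix.specialUnitaryGroup (Fin 2) ℂ) → ℝ, Continuous f → (∀ U, f U ≠ 0 → (∀ (n : ℕ) (hjn : j + 1 ≤ n) (hnK : n ≤ Ts), PlaqSmall (24 / 25 * θBal F.L γ b₀ p₀ n) (descendTo F ℰp n Ts hnK U))) → ∀ z, ContinuousOn (fun V => (J (V, z) : ℝ) * f (Φ (V, z))) {V | PlaqSmall (θBal F.L γ b₀ p₀ j) V}) ∧ (∀ V z, (J (V, z) : ℝ) ≤ CJ) ∧ (∀ V, PlaqSmall (θBal F.L γ b₀ p₀ j) V →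 0 < ∫⁻ z in {z | (∀ (n : ℕ) (hjn : j + 1 ≤ n) (hnK : n ≤ Ts), PlaqSmall (24 / 25 * θBal F.L γ b₀ p₀ n) (descendTo F ℰp n Ts hnK (Φ (V, z))))}, (J (V, z) : ENNReal) ∂τ) ∧ (∀ x y : Site (F.P Ts) 0, (((π x).tdist (π y) : ℕ) : ℝ) ≤ ((x.tdist y : ℕ) : ℝ)) ∧ (∀ y : Site (F.P j) 0, ∃ s : Finset (Site (F.P Ts) 0), (∀ x, π x = y → x ∈ s) ∧ (s.card : ℝ) ≤ ((F.L : ℝ) ^ (Ts - j)) ^ 3) ∧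
    (∃ (c Db : ℝ) (DP : Plaq (F.P Ts) 0 → PBond (F.P j) 0 → ℝ), Real.sqrt 3 * rc ≤ 3 / 16 ∧ c < 1 ∧ 0 ≤ Db ∧ (∀ p b, DP p b ≤ Db) ∧
      (∀ (z : Z) (X : GaugeField (F.P j) 0 ↥(Matrix.specialUnitaryGroup (Fin 2) ℂ)), PlaqSmall (θBal F.L γ b₀ p₀ j) X →
      ∀ (b : PBond (F.P j) 0) (v : Fin 3 → ℝ), ‖v‖ ≤ rc * (θBal F.L γ b₀ p₀ j / 4) → ∀ s ∈ Icc (0 : ℝ) 1, ∀ p : Plaq (F.P Ts) 0,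
        dist1 (GaugeField.plaqHol (Φ (update X b (X b * expPt (s • v)), z)) p)
          ≤ dist1 (GaugeField.plaqHol (Φ (X, z)) p) + DP p b * (‖v‖ / (θBal F.L γ b₀ p₀ j / 4))) ∧
      24 / 25 * θBal F.L γ b₀ p₀ Ts + 3 * (Db * rc) ≤ c * θBal F.L γ b₀ p₀ Ts) ∧
    (∀ (k : PBond (F.P Ts) 0 → PBond (F.P Ts) 0 → ℝ) (w : ℝ), 0 ≤ w → w / (((F.L : ℝ) ^ Ts / γ) * θBal F.L γ b₀ p₀ Ts ^ 2) ≤ w₀ → (∀ b b', 0 ≤ k b b') → (∀ b, ∑ b', k b b' * Real.exp (κ * (b.src.tdist b'.src : ℝ)) ≤ w) → (∀ (b b' : PBond (F.P Ts) 0) (v v' : Fin 3 → ℝ) (U V W Y : GaugeField (F.P Ts) 0 ↥(Matrix.specialUnitaryGroup (Fin 2) ℂ)), ‖v‖ ≤ (rA / 2) * (θBal F.L γ b₀ p₀ Ts / 4) → ‖v'‖ ≤ (rA / 2) * (θBal F.L γ b₀ p₀ Ts / 4) → PlaqSmall (θBal F.L γ b₀ p₀ Ts / 4) U → PlaqSmall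 (θBal F.L γ b₀ p₀ Ts / 4) V → PlaqSmall (θBal F.L γ b₀ p₀ Ts / 4) W → PlaqSmall (θBal F.L γ b₀ p₀ Ts / 4) Y → (∀ e, e ≠ b → V e = U e) → V b = U b * expPt v → (∀ e, e ≠ b' → W e = U e) → W b' = U b' * expPt v' → (∀ e, e ≠ b' → Y e = V e) → Y b' = V b' * expPt v' → |(Real.log (ρ Ts Y) - Real.log (ρ' Ts Y)) - (Real.log (ρ Ts V) - Real.log (ρ' Ts V)) - (Real.log (ρ Ts W) - Real.log (ρ' Ts W)) + (Real.log (ρ Ts U) - Real.log (ρ' Ts U))| ≤ k b b' * (‖v‖ / (θBal F.L γ b₀ p₀ Ts / 4)) * (‖v'‖ / (θBal F.L γ b₀ p₀ Ts / 4))) → 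
    (∀ t : ℝ, 0 ≤ t → t ≤ 1 →
        ∃ (kG kB : PBond (F.P j) 0 → PBond (F.P j) 0 → ℝ) (ES : ℝ), (∀ B B', 0 ≤ kG B B') ∧ (∀ B B', 0 ≤ kB B B') ∧ 0 ≤ ES ∧
        (∀ B, ∑ B', (kG B B' + ES * kB B B') * Real.exp (κ * (B.src.tdist B'.src : ℝ)) ≤ NT * ((((F.L : ℝ) ^ j / γ) * θBal F.L γ b₀ p₀ j ^ 2) / (((F.L : ℝ) ^ Ts / γ) * θBal F.L γ b₀ p₀ Ts ^ 2)) * w + δT j * (((F.L : ℝ) ^ j / γ) * θBal F.L γ b₀ p₀ j ^ 2)) ∧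
        (∀ (Xw : GaugeField (F.P j) 0 ↥(Matrix.specialUnitaryGroup (Fin 2) ℂ)), PlaqSmall (θBal F.L γ b₀ p₀ j / 4) Xw →
          ∃ Good : Set Z, MeasurableSet Good ∧ (∫ z in Goodᶜ, wgt F γ b₀ p₀ j Ts ρ ρ' τ Φ J t Xw z ∂τ ≤ ES) ∧
          (∀ (B B' : PBond (F.P j) 0) (m m' : Fin 3 → ℝ) (U V W Y : GaugeField (F.P j) 0 ↥(Matrix.specialUnitaryGroup (Fin 2) ℂ)), ‖m‖ ≤ rc * (θBal F.L γ b₀ p₀ j / 4) → ‖m'‖ ≤ rc * (θBal F.L γ b₀ p₀ j / 4) → PlaqSmall (θBal F.L γ b₀ p₀ j / 4) U → PlaqSmall (θBal F.L γ b₀ p₀ j / 4) V → PlaqSmall (θBal F.L γ b₀ p₀ j / 4) W → PlaqSmall (θBal F.L γ b₀ p₀ j / 4) Y → (∀ e, e ≠ B → V e = U e) → V B = U B * expPt m → (∀ e, e ≠ B' → W e = U e) → W B' = U B' * expPt m' → (∀ e, e ≠ B' → Y e = V e) → Y B' = V B' * expPt m' →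
          (Xw = U ∨ Xw = V ∨ Xw = W ∨ Xw = Y) →
          ∀ z ∈ Good, wgt F γ b₀ p₀ j Ts ρ ρ' τ Φ J t Xw z ≠ 0 →
      |(Real.log (ρ Ts (Φ (Y, z))) - Real.log (ρ' Ts (Φ (Y, z)))) - (Real.log (ρ Ts (Φ (V, z))) - Real.log (ρ' Ts (Φ (V, z))))
        - (Real.log (ρ Ts (Φ (W, z))) - Real.log (ρ' Ts (Φ (W, z)))) + (Real.log (ρ Ts (Φ (U, z))) - Real.log (ρ' Ts (Φ (U, z))))|
        ≤ kG B B' * (‖m‖ / (θBal F.L γ b₀ p₀ j / 4)) * (‖m'‖ / (θBal F.L γ b₀ p₀ j / 4))) ∧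
          (∀ (B B' : PBond (F.P j) 0) (m m' : Fin 3 → ℝ) (U V W Y : GaugeField (F.P j) 0 ↥(Matrix.specialUnitaryGroup (Fin 2) ℂ)), ‖m‖ ≤ rc * (θBal F.L γ b₀ p₀ j / 4) → ‖m'‖ ≤ rc * (θBal F.L γ b₀ p₀ j / 4) → PlaqSmall (θBal F.L γ b₀ p₀ j / 4) U → PlaqSmall (θBal F.L γ b₀ p₀ j / 4) V → PlaqSmall (θBal F.L γ b₀ p₀ j / 4) W → PlaqSmall (θBal F.L γ b₀ p₀ j / 4) Y → (∀ e, e ≠ B → V e = U e) → V B = U B * expPt m → (∀ e, e ≠ B' → W e = U e) → W B' = U B' * expPt m' → (∀ e, e ≠ B' → Y e = V e) → Y B' = V B' * expPt m' →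
          (Xw = U ∨ Xw = V ∨ Xw = W ∨ Xw = Y) →
          ∀ z, wgt F γ b₀ p₀ j Ts ρ ρ' τ Φ J t Xw z ≠ 0 →
      |(Real.log (ρ Ts (Φ (Y, z))) - Real.log (ρ' Ts (Φ (Y, z)))) - (Real.log (ρ Ts (Φ (V, z))) - Real.log (ρ' Ts (Φ (V, z))))
        - (Real.log (ρ Ts (Φ (W, z))) - Real.log (ρ' Ts (Φ (W, z)))) + (Real.log (ρ Ts (Φ (U, z))) - Real.log (ρ' Ts (Φ (U, z))))|
        ≤ kB B B' * (‖m‖ / (θBal F.L γ b₀ p₀ j / 4)) * (‖m'‖ / (θBal F.L γ b₀ p₀ j / 4))))) ∧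
    (∀ t : ℝ, 0 ≤ t → t ≤ 1 →
      (∃ kX : PBond (F.P j) 0 → PBond (F.P j) 0 → ℝ, (∀ B B', 0 ≤ kX B B') ∧ (∀ B, ∑ B', kX B B' * Real.exp (κ * (B.src.tdist B'.src : ℝ)) ≤ NX * ((((F.L : ℝ) ^ j / γ) * θBal F.L γ b₀ p₀ j ^ 2) / (((F.L : ℝ) ^ Ts / γ) * θBal F.L γ b₀ p₀ Ts ^ 2)) * w + δX j * (((F.L : ℝ) ^ j / γ) * θBal F.L γ b₀ p₀ j ^ 2)) ∧ (∀ B', ∑ B, kX B B' * Real.exp (κ * (B.src.tdist B'.src : ℝ)) ≤ NX * ((((F.L : ℝ) ^ j / γ) * θBal F.L γ b₀ p₀ j ^ 2) / (((F.L : ℝ) ^ Ts / γ) * θBal F.L γ b₀ p₀ Ts ^ 2)) * w + δX j * (((F.L : ℝ) ^ j / γ) * θBal F.L γ b₀ p₀ j ^ 2)) ∧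
      (∀ (B B' : PBond (F.P j) 0) (m m' : Fin 3 → ℝ) (U₁ V₁ W₂ : GaugeField (F.P j) 0 ↥(Matrix.specialUnitaryGroup (Fin 2) ℂ)), ‖m‖ ≤ rc * (θBal F.L γ b₀ p₀ j / 4) → ‖m'‖ ≤ rc * (θBal F.L γ b₀ p₀ j / 4) → PlaqSmall (θBal F.L γ b₀ p₀ j / 4) U₁ → PlaqSmall (θBal F.L γ b₀ p₀ j / 4) V₁ → PlaqSmall (θBal F.L γ b₀ p₀ j / 4) W₂ → (∀ e, e ≠ B → V₁ e = U₁ e) → V₁ B = U₁ B * expPt m → (∀ e, e ≠ B' → W₂ e = V₁ e) → W₂ B' = V₁ B' * expPt m' → ∀ (X : ℝ → GaugeField (F.P j) 0 ↥(Matrix.specialUnitaryGroup (Fin 2) ℂ)), (∀ s e, e ≠ B' → X s e = V₁ e) → (∀ s, X s B' = V₁ B' * expPt (s • m')) →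
          (∃ (b bΔ : Z → ℝ), Integrable b τ ∧ Integrable bΔ τ ∧
            (∀ᵐ z ∂τ, LipschitzOnWith (Real.nnabs (b z)) (fun s => wNum F γ b₀ p₀ j Ts ρ ρ' Φ J t (X s) z) (Set.Ioo (-1) 2)) ∧
            (∀ᵐ z ∂τ, LipschitzOnWith (Real.nnabs (bΔ z)) (fun s => ((Real.log (ρ Ts (Φ (V₁, z))) - Real.log (ρ' Ts (Φ (V₁, z)))) - (Real.log (ρ Ts (Φ (U₁, z))) - Real.log (ρ' Ts (Φ (U₁, z))))) * wNum F γ b₀ p₀ j Ts ρ ρ' Φ J t (X s) z) (Set.Ioo (-1) 2))) ∧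
            (∀ᵐ s ∂(volume : Measure ℝ), s ∈ Set.Icc (0:ℝ) 1 → |(∫ z, ((Real.log (ρ Ts (Φ (V₁, z))) - Real.log (ρ' Ts (Φ (V₁, z)))) - (Real.log (ρ Ts (Φ (U₁, z))) - Real.log (ρ' Ts (Φ (U₁, z))))) * (deriv (fun s => wNum F γ b₀ p₀ j Ts ρ ρ' Φ J t (X s) z) s / wNum F γ b₀ p₀ j Ts ρ ρ' Φ J t (X s) z) * (wNum F γ b₀ p₀ j Ts ρ ρ' Φ J t (X s) z / ∫ z', wNum F γ b₀ p₀ j Ts ρ ρ' Φ J t (X s) z' ∂τ) ∂τ)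
                - (∫ z, ((Real.log (ρ Ts (Φ (V₁, z))) - Real.log (ρ' Ts (Φ (V₁, z)))) - (Real.log (ρ Ts (Φ (U₁, z))) - Real.log (ρ' Ts (Φ (U₁, z))))) * (wNum F γ b₀ p₀ j Ts ρ ρ' Φ J t (X s) z / ∫ z', wNum F γ b₀ p₀ j Ts ρ ρ' Φ J t (X s) z' ∂τ) ∂τ) * (∫ z, (deriv (fun s => wNum F γ b₀ p₀ j Ts ρ ρ' Φ J t (X s) z) s / wNum F γ b₀ p₀ j Ts ρ ρ' Φ J t (X s) z) * (wNum F γ b₀ p₀ j Ts ρ ρ' Φ J t (X s) z / ∫ z', wNum F γ b₀ p₀ j Ts ρ ρ' Φ J t (X s) z' ∂τ) ∂τ)| ≤ kX B B' * (‖m‖ / (θBal F.L γ b₀ p₀ j / 4)) * (‖m'‖ / (θBal F.L γ b₀ p₀ j / 4))))) ∧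
      (∃ kL : PBond (F.P j) 0 → PBond (F.P j) 0 → ℝ, (∀ B B', 0 ≤ kL B B') ∧ (∀ B, ∑ B', kL B B' * Real.exp (κ * (B.src.tdist B'.src : ℝ)) ≤ NL * ((((F.L : ℝ) ^ j / γ) * θBal F.L γ b₀ p₀ j ^ 2) / (((F.L : ℝ) ^ Ts / γ) * θBal F.L γ b₀ p₀ Ts ^ 2)) * w + δL j * (((F.L : ℝ) ^ j / γ) * θBal F.L γ b₀ p₀ j ^ 2)) ∧
      (∀ (B B' : PBond (F.P j) 0) (m m' : Fin 3 → ℝ) (V00 V10 V01 V11 : GaugeField (F.P j) 0 ↥(Matrix.specialUnitaryGroup (Fin 2) ℂ)), ‖m‖ ≤ rc * (θBal F.L γ b₀ p₀ j / 4) → ‖m'‖ ≤ rc * (θBal F.L γ b₀ p₀ j / 4) → PlaqSmall (θBal F.L γ b₀ p₀ j / 4) V00 → PlaqSmall (θBal F.L γ b₀ p₀ j / 4) V10 → PlaqSmall (θBal F.L γ b₀ p₀ j / 4) V01 → PlaqSmall (θBal F.L γ b₀ p₀ j / 4) V11 → (∀ e, e ≠ B → V10 e = V00 e) → V10 B = V00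 B * expPt m → (∀ e, e ≠ B' → V01 e = V00 e) → V01 B' = V00 B' * expPt m' → (∀ e, e ≠ B' → V11 e = V10 e) → V11 B' = V10 B' * expPt m' → ∀ (Y : ℝ → GaugeField (F.P j) 0 ↥(Matrix.specialUnitaryGroup (Fin 2) ℂ)) (X : ℝ → ℝ → GaugeField (F.P j) 0 ↥(Matrix.specialUnitaryGroup (Fin 2) ℂ)), (∀ s e, e ≠ B → Y s e = V00 e) → (∀ s, Y s B = V00 B * expPt (s • m)) → (∀ s s' e, e ≠ B' → X s s' e = Y s e) → (∀ s s', X s s' B' = Y s B' * expPt (s' • m')) →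
          (∃ (b bF : Z → ℝ), Integrable b τ ∧ Integrable bF τ ∧
            (∀ s' ∈ Set.Icc (0:ℝ) 1, ∀ᵐ z ∂τ, LipschitzOnWith (Real.nnabs (b z)) (fun s => wNum F γ b₀ p₀ j Ts ρ ρ' Φ J t (X s s') z) (Set.Ioo (-1) 2)) ∧
            (∀ s' ∈ Set.Icc (0:ℝ) 1, ∀ᵐ z ∂τ, LipschitzOnWith (Real.nnabs (bF z)) (fun s => (Real.log (ρ Ts (Φ (V00, z))) - Real.log (ρ' Ts (Φ (V00, z)))) * wNum F γ b₀ p₀ j Ts ρ ρ' Φ J t (X s s') z) (Set.Ioo (-1) 2))) ∧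
            (∀ᵐ s ∂(volume : Measure ℝ), s ∈ Set.Icc (0:ℝ) 1 → |((∫ z, (Real.log (ρ Ts (Φ (V00, z))) - Real.log (ρ' Ts (Φ (V00, z)))) * (deriv (fun s => wNum F γ b₀ p₀ j Ts ρ ρ' Φ J t (X s 1) z) s / wNum F γ b₀ p₀ j Ts ρ ρ' Φ J t (X s 1) z) * (wNum F γ b₀ p₀ j Ts ρ ρ' Φ J t (X s 1) z / ∫ z', wNum F γ b₀ p₀ j Ts ρ ρ' Φ J t (X s 1) z' ∂τ) ∂τ)
                  - (∫ z, (Real.log (ρ Ts (Φ (V00, z))) - Real.log (ρ' Ts (Φ (V00, z)))) * (wNum F γ b₀ p₀ j Ts ρ ρ' Φ J t (X s 1) z / ∫ z', wNum F γ b₀ p₀ j Ts ρ ρ' Φ J t (X s 1) z' ∂τ) ∂τ) * (∫ z, (deriv (fun s => wNum F γ b₀ p₀ j Ts ρ ρ' Φ J t (X s 1) z) s / wNum F γ b₀ p₀ j Ts ρ ρ' Φ J t (X s 1) z) * (wNum F γ b₀ p₀ j Ts ρ ρ' Φ J t (X s 1) z / ∫ z', wNum F γ b₀ p₀ j Ts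 ρ ρ' Φ J t (X s 1) z' ∂τ) ∂τ))
                - ((∫ z, (Real.log (ρ Ts (Φ (V00, z))) - Real.log (ρ' Ts (Φ (V00, z)))) * (deriv (fun s => wNum F γ b₀ p₀ j Ts ρ ρ' Φ J t (X s 0) z) s / wNum F γ b₀ p₀ j Ts ρ ρ' Φ J t (X s 0) z) * (wNum F γ b₀ p₀ j Ts ρ ρ' Φ J t (X s 0) z / ∫ z', wNum F γ b₀ p₀ j Ts ρ ρ' Φ J t (X s 0) z' ∂τ) ∂τ)
                  - (∫ z, (Real.log (ρ Ts (Φ (V00, z))) - Real.log (ρ' Ts (Φ (V00, z)))) * (wNum F γ b₀ p₀ j Ts ρ ρ' Φ J t (X s 0) z / ∫ z', wNum F γ b₀ p₀ j Ts ρ ρ' Φ J t (X s 0) z' ∂τ) ∂τ) * (∫ z, (deriv (fun s => wNum F γ b₀ p₀ j Ts ρ ρ' Φ J t (X s 0) z) s / wNum F γ b₀ p₀ j Ts ρ ρ' Φ J t (X s 0) z) * (wNum F γ b₀ p₀ j Ts ρ ρ' Φ J t (X s 0) z / ∫ z', wNum F γ b₀ p₀ j Ts ρ ρ' Φ J t (X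 s 0) z' ∂τ) ∂τ))| ≤ kL B B' * (‖m‖ / (θBal F.L γ b₀ p₀ j / 4)) * (‖m'‖ / (θBal F.L γ b₀ p₀ j / 4)))))) ∧
    (∃ kV₃ : PBond (F.P j) 0 → PBond (F.P j) 0 → ℝ, (∀ B B', 0 ≤ kV₃ B B') ∧ (∀ B, ∑ B', kV₃ B B' * Real.exp (κ * (B.src.tdist B'.src : ℝ)) ≤ NV3 * ((((F.L : ℝ) ^ j / γ) * θBal F.L γ b₀ p₀ j ^ 2) / (((F.L : ℝ) ^ Ts / γ) * θBal F.L γ b₀ p₀ Ts ^ 2)) * w * (w / (((F.L : ℝ) ^ Ts / γ) * θBal F.L γ b₀ p₀ Ts ^ 2)) + δV3 j * (((F.L : ℝ) ^ j / γ) * θBal F.L γ b₀ p₀ j ^ 2)) ∧ (∀ B', ∑ B, kV₃ B B' * Real.exp (κ * (B.src.tdist B'.src : ℝ)) ≤ NV3 * ((((F.L : ℝ) ^ j / γ) * θBal F.L γ b₀ p₀ j ^ 2) / (((F.L : ℝ) ^ Ts / γ) * θBal F.L γ b₀ p₀ Ts ^ 2)) * w * (w / (((F.L : ℝ) ^ Ts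 / γ) * θBal F.L γ b₀ p₀ Ts ^ 2)) + δV3 j * (((F.L : ℝ) ^ j / γ) * θBal F.L γ b₀ p₀ j ^ 2)) ∧ ∀ t : ℝ, 0 ≤ t → t ≤ 1 → (∀ (B B' : PBond (F.P j) 0) (m m' : Fin 3 → ℝ) (U₁ V₁ W₂ : GaugeField (F.P j) 0 ↥(Matrix.specialUnitaryGroup (Fin 2) ℂ)), ‖m‖ ≤ rc * (θBal F.L γ b₀ p₀ j / 4) → ‖m'‖ ≤ rc * (θBal F.L γ b₀ p₀ j / 4) → PlaqSmall (θBal F.L γ b₀ p₀ j / 4) U₁ → PlaqSmall (θBal F.L γ b₀ p₀ j / 4) V₁ → PlaqSmall (θBal F.L γ b₀ p₀ j / 4) W₂ → (∀ e, e ≠ B → V₁ e = U₁ e) → V₁ B = U₁ B * expPt m → (∀ e, e ≠ B' → W₂ e = V₁ e) → W₂ B' = V₁ B' * expPt m' → ∀ (X : ℝ → GaugeField (F.P j) 0 ↥(Matrix.specialUnitaryGroup (Fin 2) ℂ)), (∀ s e, e ≠ B' → X s e = V₁ e) → (∀ s, X s B' = V₁ B' * expPt (s • m')) →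
            (∃ (b bD bS bDS : Z → ℝ), Integrable b τ ∧ Integrable bD τ ∧ Integrable bS τ ∧ Integrable bDS τ ∧
              (∀ᵐ z ∂τ, LipschitzOnWith (Real.nnabs (b z)) (fun s => wNum F γ b₀ p₀ j Ts ρ ρ' Φ J t (X s) z) (Set.Ioo (-1) 2)) ∧
              (∀ᵐ z ∂τ, LipschitzOnWith (Real.nnabs (bD z)) (fun s => ((Real.log (ρ Ts (Φ (V₁, z))) - Real.log (ρ' Ts (Φ (V₁, z)))) - (Real.log (ρ Ts (Φ (U₁, z))) - Real.log (ρ' Ts (Φ (U₁, z))))) * wNum F γ b₀ p₀ j Ts ρ ρ' Φ J t (X s) z) (Set.Ioo (-1) 2)) ∧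
              (∀ᵐ z ∂τ, LipschitzOnWith (Real.nnabs (bS z)) (fun s => ((Real.log (ρ Ts (Φ (V₁, z))) - Real.log (ρ' Ts (Φ (V₁, z)))) + (Real.log (ρ Ts (Φ (U₁, z))) - Real.log (ρ' Ts (Φ (U₁, z))))) * wNum F γ b₀ p₀ j Ts ρ ρ' Φ J t (X s) z) (Set.Ioo (-1) 2)) ∧
              (∀ᵐ z ∂τ, LipschitzOnWith (Real.nnabs (bDS z)) (fun s => (((Real.log (ρ Ts (Φ (V₁, z))) - Real.log (ρ' Ts (Φ (V₁, z)))) - (Real.log (ρ Ts (Φ (U₁, z))) - Real.log (ρ' Ts (Φ (U₁, z))))) * ((Real.log (ρ Ts (Φ (V₁, z))) - Real.log (ρ' Ts (Φ (V₁, z)))) + (Real.log (ρ Ts (Φ (U₁, z))) - Real.log (ρ' Ts (Φ (U₁, z)))))) * wNum F γ b₀ p₀ j Ts ρ ρ' Φ J t (X s) z) (Set.Ioo (-1) 2))) ∧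
              (∀ᵐ s ∂(volume : Measure ℝ), s ∈ Set.Icc (0:ℝ) 1 → |(((∫ z, (((Real.log (ρ Ts (Φ (V₁, z))) - Real.log (ρ' Ts (Φ (V₁, z)))) - (Real.log (ρ Ts (Φ (U₁, z))) - Real.log (ρ' Ts (Φ (U₁, z))))) * ((Real.log (ρ Ts (Φ (V₁, z))) - Real.log (ρ' Ts (Φ (V₁, z)))) + (Real.log (ρ Ts (Φ (U₁, z))) - Real.log (ρ' Ts (Φ (U₁, z)))))) * (deriv (fun s => wNum F γ b₀ p₀ j Ts ρ ρ' Φ J t (X s) z) s / wNum F γ b₀ p₀ j Ts ρ ρ' Φ J t (X s) z) * (wNum F γ b₀ p₀ j Ts ρ ρ' Φ J t (X s) z / ∫ z', wNum F γ b₀ p₀ j Ts ρ ρ' Φ J t (X s) z' ∂τ) ∂τ)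
                  - (∫ z, (((Real.log (ρ Ts (Φ (V₁, z))) - Real.log (ρ' Ts (Φ (V₁, z)))) - (Real.log (ρ Ts (Φ (U₁, z))) - Real.log (ρ' Ts (Φ (U₁, z))))) * ((Real.log (ρ Ts (Φ (V₁, z))) - Real.log (ρ' Ts (Φ (V₁, z)))) + (Real.log (ρ Ts (Φ (U₁, z))) - Real.log (ρ' Ts (Φ (U₁, z)))))) * (wNum F γ b₀ p₀ j Ts ρ ρ' Φ J t (X s) z / ∫ z', wNum F γ b₀ p₀ j Ts ρ ρ' Φ J t (X s) z' ∂τ) ∂τ) * (∫ z, (deriv (fun s => wNum F γ b₀ p₀ j Ts ρ ρ' Φ J t (X s) z) s / wNum F γ b₀ p₀ j Ts ρ ρ' Φ J t (X s) z) * (wNum F γ b₀ p₀ j Ts ρ ρ' Φ J t (X s) z / ∫ z', wNum F γ b₀ p₀ j Ts ρ ρ' Φ J t (X s) z' ∂τ) ∂τ))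
                - (((∫ z, ((Real.log (ρ Ts (Φ (V₁, z))) - Real.log (ρ' Ts (Φ (V₁, z)))) - (Real.log (ρ Ts (Φ (U₁, z))) - Real.log (ρ' Ts (Φ (U₁, z))))) * (deriv (fun s => wNum F γ b₀ p₀ j Ts ρ ρ' Φ J t (X s) z) s / wNum F γ b₀ p₀ j Ts ρ ρ' Φ J t (X s) z) * (wNum F γ b₀ p₀ j Ts ρ ρ' Φ J t (X s) z / ∫ z', wNum F γ b₀ p₀ j Ts ρ ρ' Φ J t (X s) z' ∂τ) ∂τ)
                      - (∫ z, ((Real.log (ρ Ts (Φ (V₁, z))) - Real.log (ρ' Ts (Φ (V₁, z)))) - (Real.log (ρ Ts (Φ (U₁, z))) - Real.log (ρ' Ts (Φ (U₁, z))))) * (wNum F γ b₀ p₀ j Ts ρ ρ' Φ J t (X s) z / ∫ z', wNum F γ b₀ p₀ j Ts ρ ρ' Φ J t (X s) z' ∂τ) ∂τ) * (∫ z, (deriv (fun s => wNum F γ b₀ p₀ j Ts ρ ρ' Φ J t (X s) z) s / wNum F γ b₀ p₀ j Ts ρ ρ' Φ J t (X s) z) * (wNum F γ b₀ p₀ j Ts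 ρ ρ' Φ J t (X s) z / ∫ z', wNum F γ b₀ p₀ j Ts ρ ρ' Φ J t (X s) z' ∂τ) ∂τ))
                    * (∫ z, ((Real.log (ρ Ts (Φ (V₁, z))) - Real.log (ρ' Ts (Φ (V₁, z)))) + (Real.log (ρ Ts (Φ (U₁, z))) - Real.log (ρ' Ts (Φ (U₁, z))))) * (wNum F γ b₀ p₀ j Ts ρ ρ' Φ J t (X s) z / ∫ z', wNum F γ b₀ p₀ j Ts ρ ρ' Φ J t (X s) z' ∂τ) ∂τ)
                  + (∫ z, ((Real.log (ρ Ts (Φ (V₁, z))) - Real.log (ρ' Ts (Φ (V₁, z)))) - (Real.log (ρ Ts (Φ (U₁, z))) - Real.log (ρ' Ts (Φ (U₁, z))))) * (wNum F γ b₀ p₀ j Ts ρ ρ' Φ J t (X s) z / ∫ z', wNum F γ b₀ p₀ j Ts ρ ρ' Φ J t (X s) z' ∂τ) ∂τ)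
                    * ((∫ z, ((Real.log (ρ Ts (Φ (V₁, z))) - Real.log (ρ' Ts (Φ (V₁, z)))) + (Real.log (ρ Ts (Φ (U₁, z))) - Real.log (ρ' Ts (Φ (U₁, z))))) * (deriv (fun s => wNum F γ b₀ p₀ j Ts ρ ρ' Φ J t (X s) z) s / wNum F γ b₀ p₀ j Ts ρ ρ' Φ J t (X s) z) * (wNum F γ b₀ p₀ j Ts ρ ρ' Φ J t (X s) z / ∫ z', wNum F γ b₀ p₀ j Ts ρ ρ' Φ J t (X s) z' ∂τ) ∂τ)
                      - (∫ z, ((Real.log (ρ Ts (Φ (V₁, z))) - Real.log (ρ' Ts (Φ (V₁, z)))) + (Real.log (ρ Ts (Φ (U₁, z))) - Real.log (ρ' Ts (Φ (U₁, z))))) * (wNum F γ b₀ p₀ j Ts ρ ρ' Φ J t (X s) z / ∫ z', wNum F γ b₀ p₀ j Ts ρ ρ' Φ J t (X s) z' ∂τ) ∂τ) * (∫ z, (deriv (fun s => wNum F γ b₀ p₀ j Ts ρ ρ' Φ J t (X s) z) s / wNum F γ b₀ p₀ j Ts ρ ρ' Φ J t (X s) z) * (wNum F γ b₀ p₀ j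 Ts ρ ρ' Φ J t (X s) z / ∫ z', wNum F γ b₀ p₀ j Ts ρ ρ' Φ J t (X s) z' ∂τ) ∂τ))))| ≤ kV₃ B B' * (‖m‖ / (θBal F.L γ b₀ p₀ j / 4)) * (‖m'‖ / (θBal F.L γ b₀ p₀ j / 4))))) ∧
    (∃ kV₄ : PBond (F.P j) 0 → PBond (F.P j) 0 → ℝ, (∀ B B', 0 ≤ kV₄ B B') ∧ (∀ B, ∑ B', kV₄ B B' * Real.exp (κ * (B.src.tdist B'.src : ℝ)) ≤ NV4 * ((((F.L : ℝ) ^ j / γ) * θBal F.L γ b₀ p₀ j ^ 2) / (((F.L : ℝ) ^ Ts / γ) * θBal F.L γ b₀ p₀ Ts ^ 2)) * w * (w / (((F.L : ℝ) ^ Ts / γ) * θBal F.L γ b₀ p₀ Ts ^ 2)) + δV4 j * (((F.L : ℝ) ^ j / γ) * θBal F.L γ b₀ p₀ j ^ 2)) ∧ ∀ t : ℝ, 0 ≤ t → t ≤ 1 → (∀ (B B' : PBond (F.P j) 0) (m m' : Fin 3 → ℝ) (V00 V10 V01 V11 : GaugeField (F.P j) 0 ↥(Matrix.specialUnitaryGroup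 (Fin 2) ℂ)), ‖m‖ ≤ rc * (θBal F.L γ b₀ p₀ j / 4) → ‖m'‖ ≤ rc * (θBal F.L γ b₀ p₀ j / 4) → PlaqSmall (θBal F.L γ b₀ p₀ j / 4) V00 → PlaqSmall (θBal F.L γ b₀ p₀ j / 4) V10 → PlaqSmall (θBal F.L γ b₀ p₀ j / 4) V01 → PlaqSmall (θBal F.L γ b₀ p₀ j / 4) V11 → (∀ e, e ≠ B → V10 e = V00 e) → V10 B = V00 B * expPt m → (∀ e, e ≠ B' → V01 e = V00 e) → V01 B' = V00 B' * expPt m' → (∀ e, e ≠ B' → V11 e = V10 e) → V11 B' = V10 B' * expPt m' → ∀ (Y : ℝ → GaugeField (F.P j) 0 ↥(Matrix.specialUnitaryGroup (Fin 2) ℂ)) (X : ℝ → ℝ → GaugeField (F.P j) 0 ↥(Matrix.specialUnitaryGroup (Fin 2) ℂ)), (∀ s e, e ≠ B → Y s e = V00 e) → (∀ s, Y s B = V00 B * expPt (s • m)) → (∀ s s' e, e ≠ B' → X s s' e = Y s e) → (∀ s s', X s s' B' = Y s B' * expPt (s' • m')) →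
            (∃ (b bF bFF : Z → ℝ), Integrable b τ ∧ Integrable bF τ ∧ Integrable bFF τ ∧
              (∀ s' ∈ Set.Icc (0:ℝ) 1, ∀ᵐ z ∂τ, LipschitzOnWith (Real.nnabs (b z)) (fun s => wNum F γ b₀ p₀ j Ts ρ ρ' Φ J t (X s s') z) (Set.Ioo (-1) 2)) ∧
              (∀ s' ∈ Set.Icc (0:ℝ) 1, ∀ᵐ z ∂τ, LipschitzOnWith (Real.nnabs (bF z)) (fun s => (Real.log (ρ Ts (Φ (V00, z))) - Real.log (ρ' Ts (Φ (V00, z)))) * wNum F γ b₀ p₀ j Ts ρ ρ' Φ J t (X s s') z) (Set.Ioo (-1) 2)) ∧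
              (∀ s' ∈ Set.Icc (0:ℝ) 1, ∀ᵐ z ∂τ, LipschitzOnWith (Real.nnabs (bFF z)) (fun s => ((Real.log (ρ Ts (Φ (V00, z))) - Real.log (ρ' Ts (Φ (V00, z)))) * (Real.log (ρ Ts (Φ (V00, z))) - Real.log (ρ' Ts (Φ (V00, z))))) * wNum F γ b₀ p₀ j Ts ρ ρ' Φ J t (X s s') z) (Set.Ioo (-1) 2))) ∧
              (∀ᵐ s ∂(volume : Measure ℝ), s ∈ Set.Icc (0:ℝ) 1 → |(((∫ z, ((Real.log (ρ Ts (Φ (V00, z))) - Real.log (ρ' Ts (Φ (V00, z)))) * (Real.log (ρ Ts (Φ (V00, z))) - Real.log (ρ' Ts (Φ (V00, z))))) * (deriv (fun s => wNum F γ b₀ p₀ j Ts ρ ρ' Φ J t (X s 1) z) s / wNum F γ b₀ p₀ j Ts ρ ρ' Φ J t (X s 1) z) * (wNum F γ b₀ p₀ j Ts ρ ρ' Φ J t (X s 1) z / ∫ z', wNum F γ b₀ p₀ j Ts ρ ρ' Φ J t (X s 1) z' ∂τ) ∂τ) - (∫ z, ((Real.log (ρ Ts (Φ (V00, z))) - Real.log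 (ρ' Ts (Φ (V00, z)))) * (Real.log (ρ Ts (Φ (V00, z))) - Real.log (ρ' Ts (Φ (V00, z))))) * (wNum F γ b₀ p₀ j Ts ρ ρ' Φ J t (X s 1) z / ∫ z', wNum F γ b₀ p₀ j Ts ρ ρ' Φ J t (X s 1) z' ∂τ) ∂τ) * (∫ z, (deriv (fun s => wNum F γ b₀ p₀ j Ts ρ ρ' Φ J t (X s 1) z) s / wNum F γ b₀ p₀ j Ts ρ ρ' Φ J t (X s 1) z) * (wNum F γ b₀ p₀ j Ts ρ ρ' Φ J t (X s 1) z / ∫ z', wNum F γ b₀ p₀ j Ts ρ ρ' Φ J t (X s 1) z' ∂τ) ∂τ))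
                  - (((∫ z, (Real.log (ρ Ts (Φ (V00, z))) - Real.log (ρ' Ts (Φ (V00, z)))) * (deriv (fun s => wNum F γ b₀ p₀ j Ts ρ ρ' Φ J t (X s 1) z) s / wNum F γ b₀ p₀ j Ts ρ ρ' Φ J t (X s 1) z) * (wNum F γ b₀ p₀ j Ts ρ ρ' Φ J t (X s 1) z / ∫ z', wNum F γ b₀ p₀ j Ts ρ ρ' Φ J t (X s 1) z' ∂τ) ∂τ) - (∫ z, (Real.log (ρ Ts (Φ (V00, z))) - Real.log (ρ' Ts (Φ (V00, z)))) * (wNum F γ b₀ p₀ j Ts ρ ρ' Φ J t (X s 1) z / ∫ z', wNum F γ b₀ p₀ j Ts ρ ρ' Φ J t (X s 1) z' ∂τ) ∂τ) * (∫ z, (deriv (fun s => wNum F γ b₀ p₀ j Ts ρ ρ' Φ J t (X s 1) z) s / wNum F γ b₀ p₀ j Ts ρ ρ' Φ J t (X s 1) z) * (wNum F γ b₀ p₀ j Ts ρ ρ' Φ J t (X s 1) z / ∫ z', wNum F γ b₀ p₀ j Ts ρ ρ' Φ J t (X s 1) z' ∂τ) ∂τ)) * (∫ z, (Real.log (ρ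 Ts (Φ (V00, z))) - Real.log (ρ' Ts (Φ (V00, z)))) * (wNum F γ b₀ p₀ j Ts ρ ρ' Φ J t (X s 1) z / ∫ z', wNum F γ b₀ p₀ j Ts ρ ρ' Φ J t (X s 1) z' ∂τ) ∂τ)
                    + (∫ z, (Real.log (ρ Ts (Φ (V00, z))) - Real.log (ρ' Ts (Φ (V00, z)))) * (wNum F γ b₀ p₀ j Ts ρ ρ' Φ J t (X s 1) z / ∫ z', wNum F γ b₀ p₀ j Ts ρ ρ' Φ J t (X s 1) z' ∂τ) ∂τ) * ((∫ z, (Real.log (ρ Ts (Φ (V00, z))) - Real.log (ρ' Ts (Φ (V00, z)))) * (deriv (fun s => wNum F γ b₀ p₀ j Ts ρ ρ' Φ J t (X s 1) z) s / wNum F γ b₀ p₀ j Ts ρ ρ' Φ J t (X s 1) z) * (wNum F γ b₀ p₀ j Ts ρ ρ' Φ J t (X s 1) z / ∫ z', wNum F γ b₀ p₀ j Ts ρ ρ' Φ J t (X s 1) z' ∂τ) ∂τ) - (∫ z, (Real.log (ρ Ts (Φ (V00, z))) - Real.log (ρ' Ts (Φ (V00, z)))) * (wNum F γ b₀ p₀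 j Ts ρ ρ' Φ J t (X s 1) z / ∫ z', wNum F γ b₀ p₀ j Ts ρ ρ' Φ J t (X s 1) z' ∂τ) ∂τ) * (∫ z, (deriv (fun s => wNum F γ b₀ p₀ j Ts ρ ρ' Φ J t (X s 1) z) s / wNum F γ b₀ p₀ j Ts ρ ρ' Φ J t (X s 1) z) * (wNum F γ b₀ p₀ j Ts ρ ρ' Φ J t (X s 1) z / ∫ z', wNum F γ b₀ p₀ j Ts ρ ρ' Φ J t (X s 1) z' ∂τ) ∂τ))))
                - (((∫ z, ((Real.log (ρ Ts (Φ (V00, z))) - Real.log (ρ' Ts (Φ (V00, z)))) * (Real.log (ρ Ts (Φ (V00, z))) - Real.log (ρ' Ts (Φ (V00, z))))) * (deriv (fun s => wNum F γ b₀ p₀ j Ts ρ ρ' Φ J t (X s 0) z) s / wNum F γ b₀ p₀ j Ts ρ ρ' Φ J t (X s 0) z) * (wNum F γ b₀ p₀ j Ts ρ ρ' Φ J t (X s 0) z / ∫ z', wNum F γ b₀ p₀ j Ts ρ ρ' Φ J t (X s 0) z' ∂τ) ∂τ) - (∫ z, ((Real.log (ρ Ts (Φ (V00, z))) - Real.log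 (ρ' Ts (Φ (V00, z)))) * (Real.log (ρ Ts (Φ (V00, z))) - Real.log (ρ' Ts (Φ (V00, z))))) * (wNum F γ b₀ p₀ j Ts ρ ρ' Φ J t (X s 0) z / ∫ z', wNum F γ b₀ p₀ j Ts ρ ρ' Φ J t (X s 0) z' ∂τ) ∂τ) * (∫ z, (deriv (fun s => wNum F γ b₀ p₀ j Ts ρ ρ' Φ J t (X s 0) z) s / wNum F γ b₀ p₀ j Ts ρ ρ' Φ J t (X s 0) z) * (wNum F γ b₀ p₀ j Ts ρ ρ' Φ J t (X s 0) z / ∫ z', wNum F γ b₀ p₀ j Ts ρ ρ' Φ J t (X s 0) z' ∂τ) ∂τ))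
                  - (((∫ z, (Real.log (ρ Ts (Φ (V00, z))) - Real.log (ρ' Ts (Φ (V00, z)))) * (deriv (fun s => wNum F γ b₀ p₀ j Ts ρ ρ' Φ J t (X s 0) z) s / wNum F γ b₀ p₀ j Ts ρ ρ' Φ J t (X s 0) z) * (wNum F γ b₀ p₀ j Ts ρ ρ' Φ J t (X s 0) z / ∫ z', wNum F γ b₀ p₀ j Ts ρ ρ' Φ J t (X s 0) z' ∂τ) ∂τ) - (∫ z, (Real.log (ρ Ts (Φ (V00, z))) - Real.log (ρ' Ts (Φ (V00, z)))) * (wNum F γ b₀ p₀ j Ts ρ ρ' Φ J t (X s 0) z / ∫ z', wNum F γ b₀ p₀ j Ts ρ ρ' Φ J t (X s 0) z' ∂τ) ∂τ) * (∫ z, (deriv (fun s => wNum F γ b₀ p₀ j Ts ρ ρ' Φ J t (X s 0) z) s / wNum F γ b₀ p₀ j Ts ρ ρ' Φ J t (X s 0) z) * (wNum F γ b₀ p₀ j Ts ρ ρ' Φ J t (X s 0) z / ∫ z', wNum F γ b₀ p₀ j Ts ρ ρ' Φ J t (X s 0) z' ∂τ) ∂τ)) * (∫ z, (Real.log (ρ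 Ts (Φ (V00, z))) - Real.log (ρ' Ts (Φ (V00, z)))) * (wNum F γ b₀ p₀ j Ts ρ ρ' Φ J t (X s 0) z / ∫ z', wNum F γ b₀ p₀ j Ts ρ ρ' Φ J t (X s 0) z' ∂τ) ∂τ)
                    + (∫ z, (Real.log (ρ Ts (Φ (V00, z))) - Real.log (ρ' Ts (Φ (V00, z)))) * (wNum F γ b₀ p₀ j Ts ρ ρ' Φ J t (X s 0) z / ∫ z', wNum F γ b₀ p₀ j Ts ρ ρ' Φ J t (X s 0) z' ∂τ) ∂τ) * ((∫ z, (Real.log (ρ Ts (Φ (V00, z))) - Real.log (ρ' Ts (Φ (V00, z)))) * (deriv (fun s => wNum F γ b₀ p₀ j Ts ρ ρ' Φ J t (X s 0) z) s / wNum F γ b₀ p₀ j Ts ρ ρ' Φ J t (X s 0) z) * (wNum F γ b₀ p₀ j Ts ρ ρ' Φ J t (X s 0) z / ∫ z', wNum F γ b₀ p₀ j Ts ρ ρ' Φ J t (X s 0) z' ∂τ) ∂τ) - (∫ z, (Real.log (ρ Ts (Φ (V00, z))) - Real.log (ρ' Ts (Φ (V00, z)))) * (wNum F γ b₀ p₀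 j Ts ρ ρ' Φ J t (X s 0) z / ∫ z', wNum F γ b₀ p₀ j Ts ρ ρ' Φ J t (X s 0) z' ∂τ) ∂τ) * (∫ z, (deriv (fun s => wNum F γ b₀ p₀ j Ts ρ ρ' Φ J t (X s 0) z) s / wNum F γ b₀ p₀ j Ts ρ ρ' Φ J t (X s 0) z) * (wNum F γ b₀ p₀ j Ts ρ ρ' Φ J t (X s 0) z / ∫ z', wNum F γ b₀ p₀ j Ts ρ ρ' Φ J t (X s 0) z' ∂τ) ∂τ))))| ≤ kV₄ B B' * (‖m‖ / (θBal F.L γ b₀ p₀ j / 4)) * (‖m'‖ / (θBal F.L γ b₀ p₀ j / 4))))) ∧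
    ((∃ (Prof : GaugeField (F.P j) 0 ↥(Matrix.specialUnitaryGroup (Fin 2) ℂ) → (Z → ℝ) → (Plaq (F.P Ts) 0 → ℝ) → Prop) (𝒢 ωf : Plaq (F.P Ts) 0 → Plaq (F.P Ts) 0 → ℝ) (NG NG₀ : ℝ) (K ωX : Plaq (F.P Ts) 0 → PBond (F.P j) 0 → ℝ) (Ncol Nrow : ℝ) (K2 : Plaq (F.P Ts) 0 → PBond (F.P j) 0 → PBond (F.P j) 0 → ℝ) (NY x₀ : ℝ), (∀ a c, 0 ≤ 𝒢 a c) ∧ (∀ a c, 0 ≤ ωf a c) ∧ 0 ≤ NG ∧ (∀ a, ∑ c, 𝒢 a c * ωf a c ≤ NG) ∧ 0 ≤ NG₀ ∧ (∀ a, ∑ c, 𝒢 a c ≤ NG₀) ∧ (∀ t : ℝ, 0 ≤ t → t ≤ 1 → ∀ Xw : GaugeField (F.P j) 0 ↥(Matrix.specialUnitaryGroup (Fin 2) ℂ), PlaqSmall (θBal F.L γ b₀ p₀ j / 4) Xw → ∀ (Pf Qf : Z → ℝ) (p q : Plaq (F.P Ts) 0 → ℝ), Prof Xw Pf p → Prof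 Xw Qf q → ∀ (cP cQ : ℝ), cP = ∫ z, Pf z * (wgt F γ b₀ p₀ j Ts ρ ρ' τ Φ J t) Xw z ∂τ → cQ = ∫ z, Qf z * (wgt F γ b₀ p₀ j Ts ρ ρ' τ Φ J t) Xw z ∂τ → Integrable (fun z => (Pf z - cP) * (Qf z - cQ) * (wgt F γ b₀ p₀ j Ts ρ ρ' τ Φ J t) Xw z) τ ∧ |∫ z, (Pf z - cP) * (Qf z - cQ) * (wgt F γ b₀ p₀ j Ts ρ ρ' τ Φ J t) Xw z ∂τ| ≤ ∑ a, ∑ c, |p a| * 𝒢 a c * |q c|) ∧ (∀ a B, 0 ≤ K a B) ∧ (∀ a B, 0 ≤ ωX a B) ∧ 0 ≤ Nrow ∧ (∀ B, ∑ a, K a B * ωX a B ≤ Ncol) ∧ (∀ c, ∑ B', K c B' * ωX c B' ≤ Nrow) ∧ (∀ (B B' : PBond (F.P j) 0) (a c : Plaq (F.P Ts) 0), Real.exp (κ * (B.src.tdist B'.src : ℝ)) ≤ ωX a B * ωf a c * ωX c B') ∧ (∀ (B B' : PBond (F.P j) 0) (m m' : Fin 3 → ℝ) (U V W Y : GaugeField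 (F.P j) 0 ↥(Matrix.specialUnitaryGroup (Fin 2) ℂ)), ‖m‖ ≤ rc * (θBal F.L γ b₀ p₀ j / 4) → ‖m'‖ ≤ rc * (θBal F.L γ b₀ p₀ j / 4) → PlaqSmall (θBal F.L γ b₀ p₀ j / 4) U → PlaqSmall (θBal F.L γ b₀ p₀ j / 4) V → PlaqSmall (θBal F.L γ b₀ p₀ j / 4) W → PlaqSmall (θBal F.L γ b₀ p₀ j / 4) Y → (∀ e, e ≠ B → V e = U e) → V B = U B * expPt m → (∀ e, e ≠ B' → W e = U e) → W B' = U B' * expPt m' → (∀ e, e ≠ B' → Y e = V e) → Y B' = V B' * expPt m' → Prof Y (fun z => (Real.log (ρ Ts (Φ (V, z))) - Real.log (ρ' Ts (Φ (V, z)))) - (Real.log (ρ Ts (Φ (U, z))) - Real.log (ρ' Ts (Φ (U, z))))) (fun a => ‖m‖ / (θBal F.L γ b₀ p₀ j / 4) * K a B) ∧ Prof Y (fun z => (Real.log (ρ Ts (Φ (W, z))) - Real.log (ρ' Ts (Φ (W, z)))) - (Real.log (ρ Ts (Φ (U, z))) - Real.log (ρ' Ts (Φ (U, z))))) (fun a =>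 ‖m'‖ / (θBal F.L γ b₀ p₀ j / 4) * K a B')) ∧ (∀ a B B', 0 ≤ K2 a B B') ∧ (∀ B, ∑ a, ∑ B', K2 a B B' * Real.exp (κ * (B.src.tdist B'.src : ℝ)) ≤ NY) ∧ (∀ (B B' : PBond (F.P j) 0) (m m' : Fin 3 → ℝ) (U V W Y : GaugeField (F.P j) 0 ↥(Matrix.specialUnitaryGroup (Fin 2) ℂ)), ‖m‖ ≤ rc * (θBal F.L γ b₀ p₀ j / 4) → ‖m'‖ ≤ rc * (θBal F.L γ b₀ p₀ j / 4) → PlaqSmall (θBal F.L γ b₀ p₀ j / 4) U → PlaqSmall (θBal F.L γ b₀ p₀ j / 4) V → PlaqSmall (θBal F.L γ b₀ p₀ j / 4) W → PlaqSmall (θBal F.L γ b₀ p₀ j / 4) Y → (∀ e, e ≠ B → V e = U e) → V B = U B * expPt m → (∀ e, e ≠ B' → W e = U e) → W B' = U B' * expPt m' → (∀ e, e ≠ B' → Y e = V e) → Y B' = V B' * expPt m' → Prof Y (fun z => (Real.log (ρ Ts (Φ (Y, z))) - Real.log (ρ' Ts (Φ (Y, z)))) - (Real.log (ρ Ts (Φ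 (V, z))) - Real.log (ρ' Ts (Φ (V, z)))) - (Real.log (ρ Ts (Φ (W, z))) - Real.log (ρ' Ts (Φ (W, z)))) + (Real.log (ρ Ts (Φ (U, z))) - Real.log (ρ' Ts (Φ (U, z))))) (fun a => ‖m‖ / (θBal F.L γ b₀ p₀ j / 4) * (‖m'‖ / (θBal F.L γ b₀ p₀ j / 4)) * K2 a B B')) ∧ 0 ≤ x₀ ∧ (∀ (B B' : PBond (F.P j) 0) (m m' : Fin 3 → ℝ) (U V W Y X : GaugeField (F.P j) 0 ↥(Matrix.specialUnitaryGroup (Fin 2) ℂ)), ‖m‖ ≤ rc * (θBal F.L γ b₀ p₀ j / 4) → ‖m'‖ ≤ rc * (θBal F.L γ b₀ p₀ j / 4) → PlaqSmall (θBal F.L γ b₀ p₀ j / 4) U → PlaqSmall (θBal F.L γ b₀ p₀ j / 4) V → PlaqSmall (θBal F.L γ b₀ p₀ j / 4) W → PlaqSmall (θBal F.L γ b₀ p₀ j / 4) Y → PlaqSmall (θBal F.L γ b₀ p₀ j / 4) X → (X = U ∨ X = V ∨ X = W ∨ X = Y) → (∀ e, e ≠ B → V e = U e) → V B = U B * expPt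 m → (∀ e, e ≠ B' → W e = U e) → W B' = U B' * expPt m' → (∀ e, e ≠ B' → Y e = V e) → Y B' = V B' * expPt m' → Prof Y (fun z => (Real.log (ρ Ts (Φ (X, z))) - Real.log (ρ' Ts (Φ (X, z))))) (fun _ => x₀)) ∧ Ncol * NG * Nrow ≤ (NV2 * ((((F.L : ℝ) ^ j / γ) * θBal F.L γ b₀ p₀ j ^ 2) / (((F.L : ℝ) ^ Ts / γ) * θBal F.L γ b₀ p₀ Ts ^ 2)) * w * (w / (((F.L : ℝ) ^ Ts / γ) * θBal F.L γ b₀ p₀ Ts ^ 2)) + δV2 j * (((F.L : ℝ) ^ j / γ) * θBal F.L γ b₀ p₀ j ^ 2)) ∧ x₀ * NG₀ * NY ≤ (NV1 * ((((F.L : ℝ) ^ j / γ) * θBal F.L γ b₀ p₀ j ^ 2) / (((F.L : ℝ) ^ Ts / γ) * θBal F.L γ b₀ p₀ Ts ^ 2)) * w * (w / (((F.L : ℝ) ^ Ts / γ) * θBal F.L γ b₀ p₀ Ts ^ 2)) + δV1 j * (((F.L : ℝ) ^ j / γ) * θBal F.L γ b₀ p₀ j ^ 2)))))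

end Summit.QuantumFields.YangMills.Theorems.FluctuationComparisonRegPrIntLRunpairOrganDischargeInputsHJsqV04E

end
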